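/-
Copyright: lit-balaban cell, Phase-2 proof seat p24 (gen 26).  Released under Apache 2.0 license as described in the
file LICENSE.
-/
import Literature.MathematicalPhysics.QuantumFieldTheory.Balaban1983to89.B4Lemma22ZeroLatticeLpOperators
import Literature.MathematicalPhysics.QuantumFieldTheory.Balaban1983to89.B4Lemma22ZeroLattice
import Literature.MathematicalPhysics.QuantumFieldTheory.Balaban1983to89.B4Lemma22ZeroLatticeDeriv

/-!
# `Balaban1983to89.B4Lemma22ZeroLatticeLpSchur` — [Balaban1983RegularityDecay] Lemma 2.2 (2.17) ON THE DIAGONAL `q = p ∈ [1,∞[`,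
# `□ ↦` THE WHOLE LATTICE `ηℤ^{d+1}`, `Ã = 0`, BY THE PRINTED (duality ∕ Riesz–Thorin) ROUTE, FOR ALL COMPLEX DATA `f ∈ ℓ^p`:
# the Schur-constant finite-truncation theorems of `B4Lemma22ZeroLattice` (`G_k(0)`, p24 g25) and `B4Lemma22ZeroLatticeDeriv`
# (`∂^η_μG_k(0)`, `G_k(0)∂^{η*}_μ`, r01 g51) extended to every `f : ηℤ^{d+1} → ℂ` with `Σ|f|^p < ∞`, and the three operators as
# continuous linear maps `ℓ^p(ℤ^{d+1}, ℂ) →L[ℂ] ℓ^p(ℤ^{d+1}, ℂ)` of norm `≤ c₂` (`p₁`-free constants)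

statement-level skeleton of published theorems with citation tags; proofs where landed; nothing here is a claim about
the Yang–Mills mass gap

CITATION HEADER.  T. Bałaban, *Regularity and decay of lattice Green's functions*, Commun. Math. Phys. **89** (1983)
571–597, doi:10.1007/bf01214744 [Balaban1983RegularityDecay] (cell paper B4; held text
`paper:balaban1983-cmp89-regularity-decay`, journal page = PDF page + 570): p. 577–578 [PDF 7–8] Lemma 2.2 (2.17), p. 583
[PDF 13] «For q = p = ∞, it is a special case of (2.16) … For q = p = 1 we get it by duality argument … The Riesz-Thorin
Theorem implies it for arbitrary q = p from [1, ∞]», p. 584 [PDF 14] «valid for all such sets»; [Balaban1983Higgs3] p. 433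
(the propagator `G_k(0)` on `ηℤ^{d+1}`).  Unit `lit-balaban-p24` gen 26; HOME `run/shared/lean/pub/lit-balaban/`; SKELETON row
**B4.Lem2.2** (owner r01; r01 g51 WELCOME 2026-08-25T00:29:35Z for this extension of his stem, read-only) — cells only,
proved-headed.  Companion of `B4Lemma22ZeroLatticeLpOperators` (same seat: the `η`-weighted (2.11) statements over the whole
printed parallelogram for all REAL `ℓ^p` data, kernel-Young constants depending on `p₁`; its §0 generic extension lemmas
are used here BY NAME).

WHAT IS PRINTED.  p. 578, Lemma 2.2: «… ‖G_k(□,Ã)f‖_q, ‖D^η_{Ã,μ}G_k(□,Ã)f‖_q, ‖G_k(□,Ã)D^{η*}_{Ã,μ}f‖_q ≦ c₂‖f‖_p (2.17) for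
1 ≦ p, q ≦ ∞, satisfying the condition 1/p − 1/p₁ ≦ 1/q ≦ 1/p with p₁ > d.»  p. 583: «Now we will prove the inequality
(2.17) for G_k(□). For q = p = ∞, it is a special case of (2.16), but for lack of dependence on α, and was proved above.
For q = p = 1 we get it by duality argument, i.e. using the fact that the space L^∞(□) is adjoint to L¹(□). The Riesz-Thorin
Theorem implies it for arbitrary q = p from [1, ∞].»  On the diagonal `q = p` the `η^{d+1}`-weights of the norms (2.11)
CANCEL: `‖·‖_{p,η} ≤ c₂‖·‖_{p,η}` is the counting-measure statement `(Σ|Kf|^p)^{1/p} ≤ c₂(Σ|f|^p)^{1/p}` — the form below.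

WHAT THIS MODULE PROVES (kernel-checked; theorems only; 0 `def`; 0 `sorry`; axioms standard), matrix units of the
zero-field lineage (`n = L^k`, `L = ℓ + 1 ≥ 2`, window `a ∈ [a₋,a₊]`, `m² ∈ [0,m²₊]`, `G_k(0) = B3GkZeroLattice.GkLat`, kernels
`K^{(0)} = G_k(0)`, `K^{(1)}(x,z) = n(G_k(0)(x+e_μ,z) − G_k(0)(x,z))`, `K^{(2)}(x,z) = n(G_k(0)(x,z+e_μ) − G_k(0)(x,z))` cast to
`ℂ`, COMPLEX data):
* §1 **(2.17), `q = p ∈ [1,∞[`, ON ALL OF `ℓ^p(ηℤ^{d+1}, ℂ)`, ALL THREE OPERATORS, SCHUR CONSTANTS** (`GkLat_apply_lp_le_of_lp`,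
  `GkLatD_apply_lp_le_of_lp`, `GkLat_adjDeriv_apply_lp_le_of_lp`): with THE SAME constants as the finite-truncation
  theorems `B4Lemma22ZeroLattice.GkLat_apply_lp_le` (`c₀` = the row = column constant of (1.10)) and
  `B4Lemma22ZeroLatticeDeriv.GkLatD_apply_lp_le` ∕ `GkLat_adjDeriv_apply_lp_le` (`c₂ = max(row, column)`, free of `p₁`), for
  every `k ≥ 1`, window point, real `p ≥ 1`, axis and EVERY `f : ℤ^{d+1} → ℂ` with `Σ_z‖f(z)‖^p < ∞`: every row series
  `Σ_zK^{(m)}(x,z)f(z)` converges absolutely, `x ↦ ‖(K^{(m)}f)(x)‖^p` is summable and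
  `(Σ_x‖Σ_zK^{(m)}(x,z)f(z)‖^p)^{1/p} ≤ c·(Σ_z‖f(z)‖^p)^{1/p}` — by `B4Lemma22ZeroLatticeLpOperators.lpq_bound_of_truncations`
  (truncations `S ↑ ℤ^{d+1}`, Fatou by windows) fed with the rows of `B4Lemma22ZeroLatticeLpOperators.rows_summable_bounded`.
* §2 **THE THREE OPERATORS AS CONTINUOUS LINEAR MAPS `ℓ^P(ℤ^{d+1}, ℂ) →L[ℂ] ℓ^P(ℤ^{d+1}, ℂ)` OF NORM `≤ c`** on Mathlib's `lp`
  spaces, every `ℝ≥0∞` exponent `1 ≤ P < ∞` (`GkLat_continuousLinearMap_complex`, `GkLatD_continuousLinearMap_complex`,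
  `GkLatDadj_continuousLinearMap_complex`), uniformly in `k ≥ 1` and the window.
* §3 non-vacuity (`d + 1 = 4`, `L = 2`, `p = 3/2`).
TWO CERTIFICATES.  The derivative diagonals (and the `G_k(0)` diagonal) now have two kernel certificates on all of `ℓ^p`:
`B4Lemma22ZeroLatticeLpOperators.GkLatD_lpq_le_of_lp` ∕ `GkLatDadj_lpq_le_of_lp` ∕ `GkLat_lpq_le_of_lp` at `t = s` (kernel-Young
per scale + Minkowski, real data, `η`-weighted form, constant seeing `p₁`) and this file (the print's own duality ∕
Riesz–Thorin route through `RieszThorinKernel.schur_riesz_thorin_counting` as used by the two source files, complex data,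
counting form, `p₁`-free constant).

DICTIONARY / HONEST SCOPE.  (i) `Ã = 0`, one component, `□ ↦ ηℤ^{d+1}` (the lineage's reading through the infinite-volume
limit of Neumann cubes); constants existential (on `d`, `L`, the window).  (ii) The diagonal only (`q = p < ∞`); off the
diagonal and `q = ∞` see `B4Lemma22ZeroLatticeLpOperators` (real data); `p = ∞` data: `B4Eq16ZeroLatticeBounded`,
`B4Lemma22ZeroLatticeLpOperators.GkLat_three_sup_le_of_bounded`, `B4Lemma22ZeroLatticeDeriv.GkLat_adjDeriv_apply_le`.  (iii) §2 is
existential packaging (`∃ T`, action identified pointwise, `‖T‖ ≤ c`; no `def`).  (iv) Value = the complex-data, Schur-constant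
diagonal of (2.17) on the infinite lattice for all `ℓ^p` data, all three operators; cells only on B4.Lem2.2; NOT summit
progress.
-/

namespace Literature.MathematicalPhysics.QuantumFieldTheory.Balaban1983to89.B4Lemma22ZeroLatticeLpSchur

open Finset Filter Topology
open scoped ENNReal
open Literature.MathematicalPhysics.QuantumFieldTheory.Balaban1983to89.B3GkZeroLattice (GkLat)
open Literature.MathematicalPhysics.QuantumFieldTheory.Balaban1983to89.B4Lemma22ZeroLatticeLpOperators (summable_row_mul_of_lp
  lpq_bound_of_truncations rows_summable_bounded)
open Literature.MathematicalPhysics.QuantumFieldTheory.Balaban1983to89.B4Lemma22ZeroLattice (GkLat_apply_lp_le)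
open Literature.MathematicalPhysics.QuantumFieldTheory.Balaban1983to89.B4Lemma22ZeroLatticeDeriv (GkLatD_apply_lp_le
  GkLat_adjDeriv_apply_lp_le)

noncomputable section

variable {d : ℕ}

/-! ## §0 Kernel helpers: a real row in `ℓ¹ ∩ ℓ^∞` cast to `ℂ`; the extension step in counting form -/

/-- kernel: casting a real row to `ℂ` preserves absolute summability and the bound. [folklore] -/
private theorem cast_row {K : (Fin (d + 1) → ℤ) → ℝ} {M : ℝ} (h : (Summable fun z => ‖K z‖) ∧ ∀ z, ‖K z‖ ≤ M) :
    (Summable fun z => ‖((K z : ℝ) : ℂ)‖) ∧ ∀ z, ‖((K z : ℝ) : ℂ)‖ ≤ M := by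
  refine ⟨h.1.congr fun z => ?_, fun z => ?_⟩
  · rw [Complex.norm_real]
  · rw [Complex.norm_real]; exact h.2 z

/-- kernel: the extension step in counting form shared by the three theorems — a real kernel `K` cast to `ℂ` with rows in
`ℓ¹ ∩ ℓ^∞`, a finite-truncation bound `(Σ_{x∈Λ}‖Σ_{z∈S}K(x,z)f(z)‖^p)^{1/p} ≤ c(Σ_{z∈S}‖f(z)‖^p)^{1/p}` for all finite `S, Λ`,
and `Σ_z‖f(z)‖^p < ∞` give absolute convergence, summability of `‖Kf‖^p` and the bound for the full series. [folklore] -/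
private theorem extend_diag {K : (Fin (d + 1) → ℤ) → (Fin (d + 1) → ℤ) → ℝ} {M c p : ℝ} (hc : 0 < c) (hp : 1 ≤ p)
    (hK : ∀ x, (Summable fun z => ‖K x z‖) ∧ ∀ z, ‖K x z‖ ≤ M) {f : (Fin (d + 1) → ℤ) → ℂ}
    (hf : Summable fun z => ‖f z‖ ^ p)
    (hb : ∀ (S Λ : Finset (Fin (d + 1) → ℤ)),
      (∑ x ∈ Λ, ‖∑ z ∈ S, ((K x z : ℝ) : ℂ) * f z‖ ^ p) ^ p⁻¹ ≤ c * (∑ z ∈ S, ‖f z‖ ^ p) ^ p⁻¹) :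
    (∀ x, Summable fun z => ((K x z : ℝ) : ℂ) * f z) ∧
    (Summable fun x => ‖∑' z, ((K x z : ℝ) : ℂ) * f z‖ ^ p) ∧
    (∑' x, ‖∑' z, ((K x z : ℝ) : ℂ) * f z‖ ^ p) ^ p⁻¹ ≤ c * (∑' z, ‖f z‖ ^ p) ^ p⁻¹ := by
  have hp0 : 0 < p := by linarith
  have hrow : ∀ x, Summable fun z => ((K x z : ℝ) : ℂ) * f z := fun x =>
    summable_row_mul_of_lp (cast_row (hK x)).1 (cast_row (hK x)).2 hp hf
  have hb' : ∀ (S Λ : Finset (Fin (d + 1) → ℤ)),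
      ((1 : ℝ) * ∑ x ∈ Λ, ‖∑ z ∈ S, ((K x z : ℝ) : ℂ) * f z‖ ^ p) ^ p⁻¹ ≤ c * ((1 : ℝ) * ∑ z ∈ S, ‖f z‖ ^ p) ^ p⁻¹ := by
    intro S Λ; rw [one_mul, one_mul]; exact hb S Λ
  have H := lpq_bound_of_truncations (𝕜 := ℂ) one_pos (inv_nonneg.2 hp0.le) (inv_pos.2 hp0) hp0.le hc.le hf hrow hb'
  rw [one_mul, one_mul] at H
  exact ⟨hrow, H.1, H.2⟩

/-! ## §1 (2.17), `q = p ∈ [1,∞[`, on all of `ℓ^p(ηℤ^{d+1}, ℂ)`: the three operators with Schur constants -/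

/-- **LEMMA 2.2 (2.17) ON THE DIAGONAL `q = p ∈ [1,∞[` FOR `G_k(0)` ON ALL OF `ℓ^p(ηℤ^{d+1}, ℂ)`, `Ã = 0`**: with the constant `c₀`
of `B4Lemma22ZeroLattice.GkLat_apply_lp_le` (the row = column constant of (1.10), on `d`, `L`, the window), for every
`k ≥ 1`, `a ∈ [a₋,a₊]`, `m² ∈ [0,m²₊]`, real `p ≥ 1` and EVERY `f : ℤ^{d+1} → ℂ` with `Σ_z‖f(z)‖^p < ∞`: every row series
`(G_k(0)f)(x) = Σ_zG_k(0)(x,z)f(z)` converges absolutely, `x ↦ ‖(G_k(0)f)(x)‖^p` is summable over the lattice and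
`(Σ_x‖(G_k(0)f)(x)‖^p)^{1/p} ≤ c₀(Σ_z‖f(z)‖^p)^{1/p}` — «The Riesz-Thorin Theorem implies it for arbitrary q = p from [1, ∞]»
for all of `L^p`, on `□ ↦ ηℤ^{d+1}` (on the diagonal the `η`-weights of (2.11) cancel: this IS `‖G_k(0)f‖_p ≤ c₀‖f‖_p`).
[cite: Balaban1983RegularityDecay, Lemma 2.2 (2.17) p.578; proof p.583; dictionary (□ ↦ ηℤ^{d+1}, Ã = 0, complex data)] -/
theorem GkLat_apply_lp_le_of_lp (d ℓ : ℕ) (hℓ : 1 ≤ ℓ) (amin aplus m2plus : ℝ) (ha : 0 < amin) :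
    ∃ c₀ : ℝ, 0 < c₀ ∧ ∀ (k : ℕ), 1 ≤ k → ∀ (a m2 : ℝ), amin ≤ a → a ≤ aplus → 0 ≤ m2 → m2 ≤ m2plus →
      ∀ (p : ℝ), 1 ≤ p → ∀ (f : (Fin (d + 1) → ℤ) → ℂ), (Summable fun z => ‖f z‖ ^ p) →
        (∀ x, Summable fun z => ((GkLat ℓ k a m2 x z : ℝ) : ℂ) * f z) ∧
        (Summable fun x => ‖∑' z, ((GkLat ℓ k a m2 x z : ℝ) : ℂ) * f z‖ ^ p) ∧
        (∑' x, ‖∑' z, ((GkLat ℓ k a m2 x z : ℝ) : ℂ) * f z‖ ^ p) ^ p⁻¹ ≤ c₀ * (∑' z, ‖f z‖ ^ p) ^ p⁻¹ := by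
  obtain ⟨c₀, hc₀, h⟩ := GkLat_apply_lp_le d ℓ hℓ amin aplus m2plus ha
  obtain ⟨M, -, hM⟩ := rows_summable_bounded d ℓ hℓ amin aplus m2plus ha
  refine ⟨c₀, hc₀, fun k hk a m2 h1 h2 h3 h4 p hp f hf => ?_⟩
  have _i : Inhabited (Fin (d + 1)) := ⟨0⟩
  exact extend_diag hc₀ hp (fun x => (hM k hk a m2 h1 h2 h3 h4 default x).1) hf
    fun S Λ => h k hk a m2 h1 h2 h3 h4 p hp S Λ f

/-- **LEMMA 2.2 (2.17) ON THE DIAGONAL `q = p ∈ [1,∞[` FOR `∂^η_μG_k(0)` ON ALL OF `ℓ^p(ηℤ^{d+1}, ℂ)`, `Ã = 0`**: with the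
constant `c₂ = max(row, column)` of `B4Lemma22ZeroLatticeDeriv.GkLatD_apply_lp_le` (free of `p₁`), for every `k ≥ 1`, window
point, real `p ≥ 1`, axis `μ` and EVERY `f : ℤ^{d+1} → ℂ` with `Σ_z‖f(z)‖^p < ∞`: absolute convergence of
`Σ_z n(G_k(0)(x+e_μ,z) − G_k(0)(x,z))f(z)`, summability of its `p`-th powers and
`(Σ_x‖(∂^η_μG_k(0)f)(x)‖^p)^{1/p} ≤ c₂(Σ_z‖f(z)‖^p)^{1/p}` — the printed duality ∕ Riesz–Thorin route for all of `L^p`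
(second certificate next to `B4Lemma22ZeroLatticeLpOperators.GkLatD_lpq_le_of_lp` at `t = s`).
[cite: Balaban1983RegularityDecay, Lemma 2.2 (2.17) p.578 (second operator); proof p.583; dictionary (□ ↦ ηℤ^{d+1}, Ã = 0, complex data)] -/
theorem GkLatD_apply_lp_le_of_lp (d ℓ : ℕ) (hℓ : 1 ≤ ℓ) (amin aplus m2plus : ℝ) (ha : 0 < amin) :
    ∃ c₂ : ℝ, 0 < c₂ ∧ ∀ (k : ℕ), 1 ≤ k → ∀ (a m2 : ℝ), amin ≤ a → a ≤ aplus → 0 ≤ m2 → m2 ≤ m2plus →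
      ∀ (p : ℝ), 1 ≤ p → ∀ (μ : Fin (d + 1)) (f : (Fin (d + 1) → ℤ) → ℂ), (Summable fun z => ‖f z‖ ^ p) →
        (∀ x, Summable fun z => (((((ℓ + 1) ^ k : ℕ) : ℝ) *
            (GkLat ℓ k a m2 (x + Pi.single μ 1) z - GkLat ℓ k a m2 x z) : ℝ) : ℂ) * f z) ∧
        (Summable fun x => ‖∑' z, (((((ℓ + 1) ^ k : ℕ) : ℝ) *
            (GkLat ℓ k a m2 (x + Pi.single μ 1) z - GkLat ℓ k a m2 x z) : ℝ) : ℂ) * f z‖ ^ p) ∧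
        (∑' x, ‖∑' z, (((((ℓ + 1) ^ k : ℕ) : ℝ) *
            (GkLat ℓ k a m2 (x + Pi.single μ 1) z - GkLat ℓ k a m2 x z) : ℝ) : ℂ) * f z‖ ^ p) ^ p⁻¹
          ≤ c₂ * (∑' z, ‖f z‖ ^ p) ^ p⁻¹ := by
  obtain ⟨c₂, hc₂, h⟩ := GkLatD_apply_lp_le d ℓ hℓ amin aplus m2plus ha
  obtain ⟨M, -, hM⟩ := rows_summable_bounded d ℓ hℓ amin aplus m2plus ha
  refine ⟨c₂, hc₂, fun k hk a m2 h1 h2 h3 h4 p hp μ f hf => ?_⟩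
  exact extend_diag (K := fun x z => (((ℓ + 1) ^ k : ℕ) : ℝ) * (GkLat ℓ k a m2 (x + Pi.single μ 1) z - GkLat ℓ k a m2 x z))
    hc₂ hp (fun x => (hM k hk a m2 h1 h2 h3 h4 μ x).2.1) hf fun S Λ => h k hk a m2 h1 h2 h3 h4 p hp μ S Λ f

/-- **LEMMA 2.2 (2.17) ON THE DIAGONAL `q = p ∈ [1,∞[` FOR `G_k(0)∂^{η*}_μ` ON ALL OF `ℓ^p(ηℤ^{d+1}, ℂ)`, `Ã = 0`**: with the
constant of `B4Lemma22ZeroLatticeDeriv.GkLat_adjDeriv_apply_lp_le`, for every `k ≥ 1`, window point, real `p ≥ 1`, axis `μ`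
and EVERY `f : ℤ^{d+1} → ℂ` with `Σ_z‖f(z)‖^p < ∞`: absolute convergence of `Σ_z n(G_k(0)(x,z+e_μ) − G_k(0)(x,z))f(z)`,
summability of its `p`-th powers and `(Σ_x‖(G_k(0)∂^{η*}_μf)(x)‖^p)^{1/p} ≤ c₂(Σ_z‖f(z)‖^p)^{1/p}` («by duality argument»,
the transposed kernel; second certificate next to `B4Lemma22ZeroLatticeLpOperators.GkLatDadj_lpq_le_of_lp` at `t = s`).
[cite: Balaban1983RegularityDecay, Lemma 2.2 (2.17) p.578 (third operator); proof p.583; dictionary (□ ↦ ηℤ^{d+1}, Ã = 0, complex data)] -/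
theorem GkLat_adjDeriv_apply_lp_le_of_lp (d ℓ : ℕ) (hℓ : 1 ≤ ℓ) (amin aplus m2plus : ℝ) (ha : 0 < amin) :
    ∃ c₂ : ℝ, 0 < c₂ ∧ ∀ (k : ℕ), 1 ≤ k → ∀ (a m2 : ℝ), amin ≤ a → a ≤ aplus → 0 ≤ m2 → m2 ≤ m2plus →
      ∀ (p : ℝ), 1 ≤ p → ∀ (μ : Fin (d + 1)) (f : (Fin (d + 1) → ℤ) → ℂ), (Summable fun z => ‖f z‖ ^ p) →
        (∀ x, Summable fun z => (((((ℓ + 1) ^ k : ℕ) : ℝ) *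
            (GkLat ℓ k a m2 x (z + Pi.single μ 1) - GkLat ℓ k a m2 x z) : ℝ) : ℂ) * f z) ∧
        (Summable fun x => ‖∑' z, (((((ℓ + 1) ^ k : ℕ) : ℝ) *
            (GkLat ℓ k a m2 x (z + Pi.single μ 1) - GkLat ℓ k a m2 x z) : ℝ) : ℂ) * f z‖ ^ p) ∧
        (∑' x, ‖∑' z, (((((ℓ + 1) ^ k : ℕ) : ℝ) *
            (GkLat ℓ k a m2 x (z + Pi.single μ 1) - GkLat ℓ k a m2 x z) : ℝ) : ℂ) * f z‖ ^ p) ^ p⁻¹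
          ≤ c₂ * (∑' z, ‖f z‖ ^ p) ^ p⁻¹ := by
  obtain ⟨c₂, hc₂, h⟩ := GkLat_adjDeriv_apply_lp_le d ℓ hℓ amin aplus m2plus ha
  obtain ⟨M, -, hM⟩ := rows_summable_bounded d ℓ hℓ amin aplus m2plus ha
  refine ⟨c₂, hc₂, fun k hk a m2 h1 h2 h3 h4 p hp μ f hf => ?_⟩
  exact extend_diag (K := fun x z => (((ℓ + 1) ^ k : ℕ) : ℝ) * (GkLat ℓ k a m2 x (z + Pi.single μ 1) - GkLat ℓ k a m2 x z))
    hc₂ hp (fun x => (hM k hk a m2 h1 h2 h3 h4 μ x).2.2) hf fun S Λ => h k hk a m2 h1 h2 h3 h4 p hp μ S Λ f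

/-! ## §2 The three operators as continuous linear maps `ℓ^P(ℤ^{d+1}, ℂ) →L[ℂ] ℓ^P(ℤ^{d+1}, ℂ)` of norm `≤ c` -/

/-- kernel: the packaging step — a real kernel `K` cast to `ℂ` whose series converge on every `f ∈ ℓ^P(ℤ^{d+1}, ℂ)` with the
counting-form diagonal bound at the exponent `p = P.toReal` IS a continuous linear map `ℓ^P →L[ℂ] ℓ^P` of norm `≤ c`.
[folklore] -/
private theorem clm_of_diag {K : (Fin (d + 1) → ℤ) → (Fin (d + 1) → ℤ) → ℝ} {c : ℝ} (hc : 0 < c) (P : ℝ≥0∞)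
    [Fact (1 ≤ P)] (hPr0 : 0 < P.toReal)
    (H : ∀ f : lp (fun _ : Fin (d + 1) → ℤ => ℂ) P,
      (∀ x, Summable fun z => ((K x z : ℝ) : ℂ) * f z) ∧
      (Summable fun x => ‖∑' z, ((K x z : ℝ) : ℂ) * f z‖ ^ P.toReal) ∧
      (∑' x, ‖∑' z, ((K x z : ℝ) : ℂ) * f z‖ ^ P.toReal) ^ P.toReal⁻¹ ≤ c * (∑' z, ‖f z‖ ^ P.toReal) ^ P.toReal⁻¹) :
    ∃ T : lp (fun _ : Fin (d + 1) → ℤ => ℂ) P →L[ℂ] lp (fun _ : Fin (d + 1) → ℤ => ℂ) P,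
      (∀ (f : lp (fun _ : Fin (d + 1) → ℤ => ℂ) P) (x : Fin (d + 1) → ℤ),
        (T f : (Fin (d + 1) → ℤ) → ℂ) x = ∑' z, ((K x z : ℝ) : ℂ) * f z) ∧ ‖T‖ ≤ c := by
  have himg : ∀ f : lp (fun _ : Fin (d + 1) → ℤ => ℂ) P,
      Memℓp (fun x : Fin (d + 1) → ℤ => ∑' z, ((K x z : ℝ) : ℂ) * f z) P := fun f =>
    (memℓp_gen_iff hPr0).2 (H f).2.1
  let T₀ : lp (fun _ : Fin (d + 1) → ℤ => ℂ) P →ₗ[ℂ] lp (fun _ : Fin (d + 1) → ℤ => ℂ) P :=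
    { toFun := fun f => ⟨fun x => ∑' z, ((K x z : ℝ) : ℂ) * f z, himg f⟩
      map_add' := fun f g => by
        refine lp.ext (funext fun x => ?_)
        change (∑' z, ((K x z : ℝ) : ℂ) * (f + g) z) = (∑' z, ((K x z : ℝ) : ℂ) * f z) + (∑' z, ((K x z : ℝ) : ℂ) * g z)
        rw [← ((H f).1 x).tsum_add ((H g).1 x)]
        refine tsum_congr fun z => ?_
        rw [lp.coeFn_add, Pi.add_apply, mul_add]
      map_smul' := fun c' f => by
        refine lp.ext (funext fun x => ?_)
        change (∑' z, ((K x z : ℝ) : ℂ) * (c' • f) z) = c' • (∑' z, ((K x z : ℝ) : ℂ) * f z)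
        rw [smul_eq_mul, ← tsum_mul_left]
        refine tsum_congr fun z => ?_
        rw [lp.coeFn_smul, Pi.smul_apply, smul_eq_mul]
        ring }
  have hT₀ : ∀ (f : lp (fun _ : Fin (d + 1) → ℤ => ℂ) P) (x : Fin (d + 1) → ℤ),
      (T₀ f : (Fin (d + 1) → ℤ) → ℂ) x = ∑' z, ((K x z : ℝ) : ℂ) * f z := fun f x => rfl
  have hbd : ∀ f : lp (fun _ : Fin (d + 1) → ℤ => ℂ) P, ‖T₀ f‖ ≤ c * ‖f‖ := by
    intro f
    rw [lp.norm_eq_tsum_rpow hPr0, lp.norm_eq_tsum_rpow hPr0 f, one_div]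
    have hmain := (H f).2.2
    simp only [hT₀]
    exact hmain
  refine ⟨T₀.mkContinuous c hbd, fun f x => ?_, T₀.mkContinuous_norm_le hc.le hbd⟩
  rw [LinearMap.mkContinuous_apply, hT₀]

/-- kernel: `1 ≤ P < ∞` gives `1 ≤ P.toReal` (so `0 < P.toReal`). [folklore] -/
private theorem one_le_toReal (P : ℝ≥0∞) [Fact (1 ≤ P)] (hP : P ≠ ⊤) : 1 ≤ P.toReal := by
  have hP1 : (1 : ℝ≥0∞) ≤ P := Fact.out
  simpa using ENNReal.toReal_mono hP hP1

/-- **`G_k(0) ∈ L(ℓ^p(ηℤ^{d+1}, ℂ))` AS A CONTINUOUS LINEAR MAP OF NORM `≤ c₀`** (Mathlib `lp` over `ℤ^{d+1}` with complex values,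
every `ℝ≥0∞` exponent `1 ≤ P < ∞`; the Schur constant `c₀` of `GkLat_apply_lp_le_of_lp`, uniform in `k ≥ 1`, the window and
`P`): there is `T : ℓ^P →L[ℂ] ℓ^P` with `(Tf)(x) = Σ_zG_k(0)(x,z)f(z)` and `‖T‖ ≤ c₀` — «(2.17) … for arbitrary q = p from
[1, ∞]» as an object on `□ ↦ ηℤ^{d+1}` (on the diagonal the `η`-weights cancel, so this is the (2.11)-norm statement too).
[cite: Balaban1983RegularityDecay, Lemma 2.2 (2.17) p.578; proof p.583; dictionary (□ ↦ ηℤ^{d+1}, Ã = 0, Mathlib `lp`, complex data)] -/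
theorem GkLat_continuousLinearMap_complex (d ℓ : ℕ) (hℓ : 1 ≤ ℓ) (amin aplus m2plus : ℝ) (ha : 0 < amin) :
    ∃ c₀ : ℝ, 0 < c₀ ∧ ∀ (k : ℕ), 1 ≤ k → ∀ (a m2 : ℝ), amin ≤ a → a ≤ aplus → 0 ≤ m2 → m2 ≤ m2plus →
      ∀ (P : ℝ≥0∞) [Fact (1 ≤ P)], P ≠ ⊤ →
      ∃ T : lp (fun _ : Fin (d + 1) → ℤ => ℂ) P →L[ℂ] lp (fun _ : Fin (d + 1) → ℤ => ℂ) P,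
        (∀ (f : lp (fun _ : Fin (d + 1) → ℤ => ℂ) P) (x : Fin (d + 1) → ℤ),
          (T f : (Fin (d + 1) → ℤ) → ℂ) x = ∑' z, ((GkLat ℓ k a m2 x z : ℝ) : ℂ) * f z) ∧ ‖T‖ ≤ c₀ := by
  obtain ⟨c₀, hc₀, h⟩ := GkLat_apply_lp_le_of_lp d ℓ hℓ amin aplus m2plus ha
  refine ⟨c₀, hc₀, fun k hk a m2 h1 h2 h3 h4 P _ hP => ?_⟩
  have hPr := one_le_toReal P hP
  exact clm_of_diag hc₀ P (by linarith) fun f =>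
    h k hk a m2 h1 h2 h3 h4 P.toReal hPr f ((memℓp_gen_iff (by linarith)).1 (lp.memℓp f))

/-- **`∂^η_μG_k(0) ∈ L(ℓ^p(ηℤ^{d+1}, ℂ))` AS A CONTINUOUS LINEAR MAP OF NORM `≤ c₂`** (`c₂` of `GkLatD_apply_lp_le_of_lp`, free of
`p₁`; every axis `μ`, every `1 ≤ P < ∞`).
[cite: Balaban1983RegularityDecay, Lemma 2.2 (2.17) p.578 (second operator); proof p.583; dictionary (□ ↦ ηℤ^{d+1}, Ã = 0, Mathlib `lp`, complex data)] -/
theorem GkLatD_continuousLinearMap_complex (d ℓ : ℕ) (hℓ : 1 ≤ ℓ) (amin aplus m2plus : ℝ) (ha : 0 < amin) :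
    ∃ c₂ : ℝ, 0 < c₂ ∧ ∀ (k : ℕ), 1 ≤ k → ∀ (a m2 : ℝ), amin ≤ a → a ≤ aplus → 0 ≤ m2 → m2 ≤ m2plus →
      ∀ (μ : Fin (d + 1)) (P : ℝ≥0∞) [Fact (1 ≤ P)], P ≠ ⊤ →
      ∃ T : lp (fun _ : Fin (d + 1) → ℤ => ℂ) P →L[ℂ] lp (fun _ : Fin (d + 1) → ℤ => ℂ) P,
        (∀ (f : lp (fun _ : Fin (d + 1) → ℤ => ℂ) P) (x : Fin (d + 1) → ℤ),
          (T f : (Fin (d + 1) → ℤ) → ℂ) x = ∑' z, (((((ℓ + 1) ^ k : ℕ) : ℝ) *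
            (GkLat ℓ k a m2 (x + Pi.single μ 1) z - GkLat ℓ k a m2 x z) : ℝ) : ℂ) * f z) ∧ ‖T‖ ≤ c₂ := by
  obtain ⟨c₂, hc₂, h⟩ := GkLatD_apply_lp_le_of_lp d ℓ hℓ amin aplus m2plus ha
  refine ⟨c₂, hc₂, fun k hk a m2 h1 h2 h3 h4 μ P _ hP => ?_⟩
  have hPr := one_le_toReal P hP
  exact clm_of_diag (K := fun x z => (((ℓ + 1) ^ k : ℕ) : ℝ) * (GkLat ℓ k a m2 (x + Pi.single μ 1) z - GkLat ℓ k a m2 x z))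
    hc₂ P (by linarith) fun f => h k hk a m2 h1 h2 h3 h4 P.toReal hPr μ f ((memℓp_gen_iff (by linarith)).1 (lp.memℓp f))

/-- **`G_k(0)∂^{η*}_μ ∈ L(ℓ^p(ηℤ^{d+1}, ℂ))` AS A CONTINUOUS LINEAR MAP OF NORM `≤ c₂`** (`c₂` of
`GkLat_adjDeriv_apply_lp_le_of_lp`; every axis `μ`, every `1 ≤ P < ∞`).
[cite: Balaban1983RegularityDecay, Lemma 2.2 (2.17) p.578 (third operator); proof p.583; dictionary (□ ↦ ηℤ^{d+1}, Ã = 0, Mathlib `lp`, complex data)] -/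
theorem GkLatDadj_continuousLinearMap_complex (d ℓ : ℕ) (hℓ : 1 ≤ ℓ) (amin aplus m2plus : ℝ) (ha : 0 < amin) :
    ∃ c₂ : ℝ, 0 < c₂ ∧ ∀ (k : ℕ), 1 ≤ k → ∀ (a m2 : ℝ), amin ≤ a → a ≤ aplus → 0 ≤ m2 → m2 ≤ m2plus →
      ∀ (μ : Fin (d + 1)) (P : ℝ≥0∞) [Fact (1 ≤ P)], P ≠ ⊤ →
      ∃ T : lp (fun _ : Fin (d + 1) → ℤ => ℂ) P →L[ℂ] lp (fun _ : Fin (d + 1) → ℤ => ℂ) P,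
        (∀ (f : lp (fun _ : Fin (d + 1) → ℤ => ℂ) P) (x : Fin (d + 1) → ℤ),
          (T f : (Fin (d + 1) → ℤ) → ℂ) x = ∑' z, (((((ℓ + 1) ^ k : ℕ) : ℝ) *
            (GkLat ℓ k a m2 x (z + Pi.single μ 1) - GkLat ℓ k a m2 x z) : ℝ) : ℂ) * f z) ∧ ‖T‖ ≤ c₂ := by
  obtain ⟨c₂, hc₂, h⟩ := GkLat_adjDeriv_apply_lp_le_of_lp d ℓ hℓ amin aplus m2plus ha
  refine ⟨c₂, hc₂, fun k hk a m2 h1 h2 h3 h4 μ P _ hP => ?_⟩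
  have hPr := one_le_toReal P hP
  exact clm_of_diag (K := fun x z => (((ℓ + 1) ^ k : ℕ) : ℝ) * (GkLat ℓ k a m2 x (z + Pi.single μ 1) - GkLat ℓ k a m2 x z))
    hc₂ P (by linarith) fun f => h k hk a m2 h1 h2 h3 h4 P.toReal hPr μ f ((memℓp_gen_iff (by linarith)).1 (lp.memℓp f))

/-! ## §3 Non-vacuity: the hypotheses are met (`d + 1 = 4`, `L = 2`, window `a ∈ [1/2, 2]`, `m² ∈ [0, 1]`, `p = 3/2`) -/

/-- the diagonal of (2.17) on all of `ℓ^p(ℤ⁴, ℂ)` for `G_k(0)`, `L = 2`. -/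
example : ∃ c₀ : ℝ, 0 < c₀ ∧ ∀ (k : ℕ), 1 ≤ k → ∀ (a m2 : ℝ), (1 / 2 : ℝ) ≤ a → a ≤ 2 → 0 ≤ m2 → m2 ≤ 1 →
      ∀ (p : ℝ), 1 ≤ p → ∀ (f : (Fin (3 + 1) → ℤ) → ℂ), (Summable fun z => ‖f z‖ ^ p) →
        (∀ x, Summable fun z => ((GkLat 1 k a m2 x z : ℝ) : ℂ) * f z) ∧
        (Summable fun x => ‖∑' z, ((GkLat 1 k a m2 x z : ℝ) : ℂ) * f z‖ ^ p) ∧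
        (∑' x, ‖∑' z, ((GkLat 1 k a m2 x z : ℝ) : ℂ) * f z‖ ^ p) ^ p⁻¹ ≤ c₀ * (∑' z, ‖f z‖ ^ p) ^ p⁻¹ :=
  GkLat_apply_lp_le_of_lp 3 1 le_rfl (1 / 2) 2 1 (by norm_num)

/-- the quantifier prefix is inhabited (`k = 1`, `a = 1`, `m² = 0`, `p = 3/2`, `P = 3/2 ∈ [1, ∞[`), with a datum of infinite
support in `ℓ^{3/2}(ℤ⁴, ℂ)`: `f = i·g`, `g(x) = 2^{−|x₀|}` on the axis `x₁ = x₂ = x₃ = 0`, zero elsewhere (`Σ‖f‖^{3/2} = Σ 2^{−3|x₀|/2} < ∞`). -/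
example : (1 : ℕ) ≤ 1 ∧ (1 / 2 : ℝ) ≤ 1 ∧ (1 : ℝ) ≤ 2 ∧ (0 : ℝ) ≤ 0 ∧ (0 : ℝ) ≤ 1 ∧ (1 : ℝ) ≤ 3 / 2 ∧
    ((1 : ℝ≥0∞) ≤ ENNReal.ofReal (3 / 2) ∧ ENNReal.ofReal (3 / 2) ≠ ⊤) ∧
    (let f : (Fin (3 + 1) → ℤ) → ℂ :=
      fun x => if (∀ i, i ≠ 0 → x i = 0) then Complex.I * (((2 : ℝ)⁻¹ ^ (x 0).natAbs : ℝ) : ℂ) else 0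
     (Summable fun z => ‖f z‖ ^ (3 / 2 : ℝ)) ∧ ¬ (Function.support f).Finite) := by
  refine ⟨le_rfl, by norm_num, by norm_num, le_rfl, by norm_num, by norm_num,
    ⟨by rw [← ENNReal.ofReal_one]; exact ENNReal.ofReal_le_ofReal (by norm_num), ENNReal.ofReal_ne_top⟩, ?_⟩
  intro f
  set e : ℤ → (Fin (3 + 1) → ℤ) := fun n => Pi.single 0 n with he
  have he0 : ∀ n, e n 0 = n := fun n => by simp [he]
  have hei : ∀ n (i : Fin (3 + 1)), i ≠ 0 → e n i = 0 := fun n i hi => by simp [he, Pi.single_eq_of_ne hi]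
  have he_inj : Function.Injective e := fun m n h => by
    have := congrFun h 0
    rwa [he0, he0] at this
  have hfe : ∀ n, f (e n) = Complex.I * (((2 : ℝ)⁻¹ ^ n.natAbs : ℝ) : ℂ) := fun n => by
    simp only [f, if_pos (hei n), he0]
  have hnorm : ∀ n, ‖f (e n)‖ = (2 : ℝ)⁻¹ ^ n.natAbs := fun n => by
    rw [hfe, norm_mul, Complex.norm_I, one_mul, Complex.norm_real, Real.norm_eq_abs, abs_of_nonneg (by positivity)]
  have hout : ∀ x ∉ Set.range e, f x = 0 := by
    intro x hx
    by_cases hc : ∀ i : Fin (3 + 1), i ≠ 0 → x i = 0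
    · refine absurd ⟨x 0, ?_⟩ hx
      ext i
      by_cases hi : i = 0
      · subst hi; exact he0 _
      · rw [hei _ i hi, hc i hi]
    · simp only [f, if_neg hc]
  -- `Σ_n (2^{−|n|})^{3/2} = Σ_n (2^{−3/2})^{|n|}` over `ℤ`: two geometric series
  have hr : (0 : ℝ) ≤ (2 : ℝ)⁻¹ ^ (3 / 2 : ℝ) := by positivity
  have hr1 : (2 : ℝ)⁻¹ ^ (3 / 2 : ℝ) < 1 := Real.rpow_lt_one (by norm_num) (by norm_num) (by norm_num)
  have hgeom : Summable fun n : ℕ => ((2 : ℝ)⁻¹ ^ (3 / 2 : ℝ)) ^ n := summable_geometric_of_lt_one hr hr1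
  have hpow : ∀ n : ℕ, ((2 : ℝ)⁻¹ ^ n) ^ (3 / 2 : ℝ) = ((2 : ℝ)⁻¹ ^ (3 / 2 : ℝ)) ^ n := fun n => by
    rw [← Real.rpow_natCast, ← Real.rpow_natCast, ← Real.rpow_mul (by norm_num), ← Real.rpow_mul (by norm_num), mul_comm]
  have hZ : Summable fun n : ℤ => ((2 : ℝ)⁻¹ ^ n.natAbs) ^ (3 / 2 : ℝ) := by
    refine summable_int_iff_summable_nat_and_neg.2 ⟨?_, ?_⟩
    · exact hgeom.congr fun n => by rw [Int.natAbs_natCast, hpow]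
    · exact hgeom.congr fun n => by rw [Int.natAbs_neg, Int.natAbs_natCast, hpow]
  refine ⟨?_, fun hfin => ?_⟩
  · have hout' : ∀ x ∉ Set.range e, (fun z => ‖f z‖ ^ (3 / 2 : ℝ)) x = 0 := fun x hx => by
      simp only [hout x hx, norm_zero, Real.zero_rpow (by norm_num : (3 / 2 : ℝ) ≠ 0)]
    exact (he_inj.summable_iff hout').1 (hZ.congr fun n => by simp only [Function.comp_apply, hnorm])
  · have hsub : Set.range e ⊆ Function.support f := by
      rintro _ ⟨n, rfl⟩
      rw [Function.mem_support, ← norm_pos_iff, hnorm]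
      positivity
    exact (Set.infinite_range_of_injective he_inj).mono hsub hfin

end

end Literature.MathematicalPhysics.QuantumFieldTheory.Balaban1983to89.B4Lemma22ZeroLatticeLpSchur
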